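import Literature.Probability.RandomPlanarGeometry.SLEImageBracketCell
import Literature.Probability.RandomPlanarGeometry.SLEImageOscillationTail
import HarnessLib

/-!
# The bracket of the localised image driving function of SLE₆, II: the cell estimate in expectation

Sequel of `SLEImageBracketCell` (G. F. Lawler, O. Schramm, W. Werner, Acta Math. **187** (2001), Thm. 2.2;
[LSW] 2003 §5: at `κ = 6`, `W̃_t = h_t(W_t)` is a continuous local martingale with bracket
`6 ∫₀ᵗ h_s'(W_s)² ds`). For `Zⁿ = (Mⁿ)² − 6 · imgClockK` (`Mⁿ = imgMartK 6 hA hne n`) we prove the CELL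
ESTIMATE `abs_setIntegral_imgBracketCell_le`:
`|∫_S (Zⁿ_{u+h} − Zⁿ_u)| ≤ (1 + 6N₀) C h√h + (D² + 2N₀D + 6h) P(u < T < u+h) + 12 h cellErr + K h²`,
from the cell decomposition `indicator_imgBracket_sub_eq`: the conditional one-step second moment
`E[g ((ΔΦ)² − 6 Φ'² h)] = O(h^{3/2})` and first moment (weight `g Mⁿ_u`, rescaled into `[0, 1]`) by
`exists_abs_integral_mul_imageDrv_sub_le` (`SLEImageDriverIncrement`), and the defect bound
`abs_imgBracketDefect_le` integrated with the Gaussian tail of the oscillation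
(`measureReal_oscFn_incr_ge_le_pow_four`: `P(Bad) ≤ 768 h⁴/a⁸`) and the fourth moment of the running
supremum (`integral_indicator_oscFn_mul_runSup_pow_le`), both from `SLEImageOscillationTail`.

## References

* G. F. Lawler, O. Schramm, W. Werner, Acta Math. **187** (2001), Thm. 2.2. [LawlerSchrammWerner2001]
* [LSW] 2003, §5 (remark after (5.1)). [LawlerSchrammWerner2003Restriction]
* D. Revuz, M. Yor (1999), Ch. II Prop. (1.8). [RevuzYor1999]
-/

noncomputable section

open Set Filter Metric Function MeasureTheory ProbabilityTheory
open _root_.Complex _root_.Topology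
open Literature.Probability.Process (brownian preWienerMeasure runSup)
open scoped NNReal

namespace Literature.Probability.RandomPlanarGeometry

open Loewner PathOps

variable {A : Set ℂ} {hA : IsStarHull A} {hne : A.Nonempty} {n : ℕ}

/-! ### Integrating a five-term indicator bound -/

section Integrate

/-- **Integrating a five-term indicator bound**: if
`|b| ≤ 𝟙_E D₀ + c₀ + a₁ 𝟙_B + a₂ 𝟙_B X + a₃ 𝟙_B X²` pointwise with `b`, `𝟙_B X`, `𝟙_B X²` integrable, then
`|∫ b| ≤ D₀ P(E) + c₀ + a₁ P(B) + a₂ ∫ 𝟙_B X + a₃ ∫ 𝟙_B X²`. [folklore] -/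
theorem abs_integral_le_of_five_terms {E B : Set (ℝ≥0 → ℝ)} (hEm : MeasurableSet E) (hBm : MeasurableSet B)
    {b X : (ℝ≥0 → ℝ) → ℝ} (ib : Integrable b preWienerMeasure)
    (iX : Integrable (fun ω ↦ B.indicator (fun _ ↦ (1 : ℝ)) ω * X ω) preWienerMeasure)
    (iX2 : Integrable (fun ω ↦ B.indicator (fun _ ↦ (1 : ℝ)) ω * X ω ^ 2) preWienerMeasure) {D₀ c₀ a₁ a₂ a₃ : ℝ}
    (hpt : ∀ ω, |b ω| ≤ E.indicator (fun _ ↦ D₀) ω + c₀ + a₁ * B.indicator (fun _ ↦ (1 : ℝ)) ω +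
      a₂ * (B.indicator (fun _ ↦ (1 : ℝ)) ω * X ω) + a₃ * (B.indicator (fun _ ↦ (1 : ℝ)) ω * X ω ^ 2)) :
    |∫ ω, b ω ∂preWienerMeasure| ≤ D₀ * preWienerMeasure.real E + c₀ + a₁ * preWienerMeasure.real B +
      a₂ * ∫ ω, B.indicator (fun _ ↦ (1 : ℝ)) ω * X ω ∂preWienerMeasure +
      a₃ * ∫ ω, B.indicator (fun _ ↦ (1 : ℝ)) ω * X ω ^ 2 ∂preWienerMeasure := by
  haveI := isProbabilityMeasure_preWienerMeasure'
  have iE : Integrable (E.indicator fun _ ↦ D₀) preWienerMeasure := (integrable_const D₀).indicator hEm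
  have iB : Integrable (B.indicator fun _ ↦ (1 : ℝ)) preWienerMeasure := (integrable_const (1 : ℝ)).indicator hBm
  have i1 : Integrable (fun ω ↦ E.indicator (fun _ ↦ D₀) ω + c₀) preWienerMeasure := iE.add (integrable_const _)
  have i2 : Integrable (fun ω ↦ E.indicator (fun _ ↦ D₀) ω + c₀ + a₁ * B.indicator (fun _ ↦ (1 : ℝ)) ω) preWienerMeasure :=
    i1.add (iB.const_mul _)
  have i3 : Integrable (fun ω ↦ E.indicator (fun _ ↦ D₀) ω + c₀ + a₁ * B.indicator (fun _ ↦ (1 : ℝ)) ω +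
      a₂ * (B.indicator (fun _ ↦ (1 : ℝ)) ω * X ω)) preWienerMeasure := i2.add (iX.const_mul _)
  have i4 : Integrable (fun ω ↦ E.indicator (fun _ ↦ D₀) ω + c₀ + a₁ * B.indicator (fun _ ↦ (1 : ℝ)) ω +
      a₂ * (B.indicator (fun _ ↦ (1 : ℝ)) ω * X ω) + a₃ * (B.indicator (fun _ ↦ (1 : ℝ)) ω * X ω ^ 2)) preWienerMeasure :=
    i3.add (iX2.const_mul _)
  have iB' : Integrable (fun ω ↦ a₁ * B.indicator (fun _ ↦ (1 : ℝ)) ω) preWienerMeasure := iB.const_mul _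
  have iX' : Integrable (fun ω ↦ a₂ * (B.indicator (fun _ ↦ (1 : ℝ)) ω * X ω)) preWienerMeasure := iX.const_mul _
  have iX2' : Integrable (fun ω ↦ a₃ * (B.indicator (fun _ ↦ (1 : ℝ)) ω * X ω ^ 2)) preWienerMeasure := iX2.const_mul _
  calc |∫ ω, b ω ∂preWienerMeasure| ≤ ∫ ω, |b ω| ∂preWienerMeasure := abs_integral_le_integral_abs
    _ ≤ _ := integral_mono ib.abs i4 hpt
    _ = _ := by
        rw [integral_add i3 iX2', integral_add i2 iX', integral_add i1 iB', integral_add iE (integrable_const _),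
          integral_const_mul, integral_const_mul, integral_const_mul, integral_indicator_const _ hEm,
          integral_indicator_const _ hBm, integral_const]
        simp only [smul_eq_mul, probReal_univ, mul_one, one_mul]
        ring

end Integrate

/-! ### The integral of the compensated square over one cell -/

section Cell

variable [MeasurableSpace C(ℝ≥0, ℝ)] [BorelSpace C(ℝ≥0, ℝ)]

set_option maxHeartbeats 800000 in
/-- **The cell estimate for `Zⁿ = (Mⁿ)² − 6 imgClockK` in expectation.** Let `C` be a constant of the
one-step estimates `exists_abs_integral_mul_imageDrv_sub_le` (both moments) at `(δ₀, ρ₀) = (cₙ, cₙ/8)` with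
horizon `t₁`, let `A ⊆ B̄(0, R)`. For `s ≤ u ≤ t₁`, `S ∈ 𝓕_s`, a threshold `κ₀ > 0` and a small step `h ≤ 1`:
`|∫_S (Zⁿ_{u+h} − Zⁿ_u)| ≤ (1 + 6N₀) C h√h + (D² + 2N₀D + 6h) P(u < T < u+h) + 12 h cellErr n κ₀ h + K h²` with
`K = K(n, R, t₁, κ₀)` explicit. [cite: LawlerSchrammWerner2001, Thm. 2.2] -/
theorem abs_setIntegral_imgBracketCell_le (hA : IsStarHull A) (hne : A.Nonempty) {R : ℝ} (hR0 : 0 < R)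
    (hAR : A ⊆ closedBall (0 : ℂ) R) {t₁ : ℝ≥0} {C : ℝ}
    (hC : ∀ (u h : ℝ≥0), u ≤ t₁ → 0 < h → 192 * (h : ℝ) ≤ (locLevel n * (locLevel n / 8) / 4000) ^ 2 →
      ∀ {g : (ℝ≥0 → ℝ) → ℝ}, Measurable[brownianFiltration u] g → (∀ ω, g ω ∈ Icc (0 : ℝ) 1) →
        (∀ ω, g ω ≠ 0 → Disjoint (closedHull (drvK 6 (brownianCPath ω)) u) A ∧
          Disjoint (ball (0 : ℂ) (8 * (locLevel n / 8))) (slidHull (drvK 6 (brownianCPath ω)) A u) ∧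
            locLevel n ≤ starDeriv (slidHull (drvK 6 (brownianCPath ω)) A u)) →
        |∫ ω, g ω * (imageDrvFnK 6 A (u + h) (brownianCPath ω) - imageDrvFnK 6 A u (brownianCPath ω)) ∂preWienerMeasure| ≤
          C * h * Real.sqrt h ∧
        |∫ ω, g ω * ((imageDrvFnK 6 A (u + h) (brownianCPath ω) - imageDrvFnK 6 A u (brownianCPath ω)) ^ 2 -
            6 * starDeriv (slidHull (drvK 6 (brownianCPath ω)) A u) ^ 2 * h) ∂preWienerMeasure| ≤ C * h * Real.sqrt h)
    {s u h : ℝ≥0} (hsu : s ≤ u) (hut : u ≤ t₁) {S : Set (ℝ≥0 → ℝ)} (hS : MeasurableSet[brownianFiltration s] S)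
    {κ₀ : ℝ} (hκ₀ : 0 < κ₀) (hh0 : 0 < h) (hh1 : (h : ℝ) ≤ 1)
    (hhc : 192 * (h : ℝ) ≤ (locLevel n * (locLevel n / 8) / 4000) ^ 2)
    (hh2 : stepSize κ₀ h ≤ locLevel n * (locLevel n / 16) / 1000) :
    |∫ ω in S, ((imgMartK 6 hA hne n (u + h) ω ^ 2 - 6 * imgClockK 6 hA hne n (u + h) ω) -
        (imgMartK 6 hA hne n u ω ^ 2 - 6 * imgClockK 6 hA hne n u ω)) ∂preWienerMeasure| ≤
      (1 + 6 * (((n : ℝ) + 1) + 1160 * (3 * ((n : ℝ) + 1) + 13 * Real.sqrt ((n : ℝ) + 1) + R))) * (C * h * Real.sqrt h) +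
        ((50 * (h : ℝ) / (locLevel n / 16) + 4 * κ₀) ^ 2 + 2 * (((n : ℝ) + 1) + 1160 * (3 * ((n : ℝ) + 1) + 13 * Real.sqrt ((n : ℝ) + 1) + R)) * (50 * (h : ℝ) / (locLevel n / 16) + 4 * κ₀) + 6 * (h : ℝ)) *
          preWienerMeasure.real {ω | (u : WithTop ℝ≥0) < imgLocTimeK 6 hA hne n ω ∧
            imgLocTimeK 6 hA hne n ω < ((u + h : ℝ≥0) : WithTop ℝ≥0)} +
        12 * h * cellErr n κ₀ h +
        (((8 * (((n : ℝ) + 1) + 1160 * (3 * ((n : ℝ) + 1) + 13 * Real.sqrt ((n : ℝ) + 1) + R)) ^ 2 + 2 * (15080 * Real.sqrt ((t₁ : ℝ) + 1) + 1160 * R) ^ 2 + 2 * (((n : ℝ) + 1) + 1160 * (3 * ((n : ℝ) + 1) + 13 * Real.sqrt ((n : ℝ) + 1) + R)) * (15080 * Real.sqrt ((t₁ : ℝ) + 1) + 1160 * R) + 12) + (2 * (((n : ℝ) + 1) + 1160 * (3 * ((n : ℝ) + 1) + 13 * Real.sqrt ((n : ℝ) + 1) + R)) * (3482 * Real.sqrt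 6) + 4 * (15080 * Real.sqrt ((t₁ : ℝ) + 1) + 1160 * R) * (3482 * Real.sqrt 6)) + (2 * (3482 * Real.sqrt 6) ^ 2)) * (768 / (κ₀ / Real.sqrt 6) ^ 8) + ((2 * (((n : ℝ) + 1) + 1160 * (3 * ((n : ℝ) + 1) + 13 * Real.sqrt ((n : ℝ) + 1) + R)) * (3482 * Real.sqrt 6) + 4 * (15080 * Real.sqrt ((t₁ : ℝ) + 1) + 1160 * R) * (3482 * Real.sqrt 6)) + (2 * (3482 * Real.sqrt 6) ^ 2)) * (18 * ((t₁ : ℝ) + 1) ^ 2)) * (h : ℝ) ^ 2 := by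
  haveI := isProbabilityMeasure_preWienerMeasure'
  obtain ⟨hc0, hc1⟩ := locLevel_pos_le n
  have hSm : MeasurableSet S := brownianFiltration.le s _ hS
  obtain ⟨hEgt_u, hEgt, hElt⟩ := measurableSet_lt_imgLocTimeK (κ := 6) (hA := hA) (hne := hne) n u (u + h)
  -- constants
  set N₀ : ℝ := (((n : ℝ) + 1) + 1160 * (3 * ((n : ℝ) + 1) + 13 * Real.sqrt ((n : ℝ) + 1) + R)) with hN₀
  set Q : ℝ := (15080 * Real.sqrt ((t₁ : ℝ) + 1) + 1160 * R) with hQ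
  set M₁ : ℝ := (3482 * Real.sqrt 6) with hM₁
  set D : ℝ := (50 * (h : ℝ) / (locLevel n / 16) + 4 * κ₀) with hD
  have hN₀1 : 1 ≤ N₀ := by
    rw [hN₀]
    have : (0 : ℝ) ≤ 1160 * (3 * ((n : ℝ) + 1) + 13 * Real.sqrt ((n : ℝ) + 1) + R) := by positivity
    have : (0 : ℝ) ≤ n := n.cast_nonneg
    linarith
  have hN₀0 : 0 < N₀ := lt_of_lt_of_le one_pos hN₀1
  have hQ0 : 0 ≤ Q := by positivity
  have hM₁0 : 0 ≤ M₁ := by positivity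
  have hD0 : 0 ≤ D := by positivity
  have hN₀M : ∀ t ω, |imgMartK 6 hA hne n t ω| ≤ N₀ := fun t ω ↦ abs_imgMartK_le hR0 hAR t ω
  -- the weight `g0 = 𝟙_S 𝟙{u < T}` and the rescaled weight `g1 = g0 (M_u + N₀)/(2N₀)`
  set g0 : (ℝ≥0 → ℝ) → ℝ := fun ω ↦ S.indicator (fun _ ↦ (1 : ℝ)) ω *
    {ω | (u : WithTop ℝ≥0) < imgLocTimeK 6 hA hne n ω}.indicator (fun _ ↦ (1 : ℝ)) ω with hg0
  have hg0mu : Measurable[brownianFiltration u] g0 :=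
    ((measurable_const (a := (1 : ℝ))).indicator (brownianFiltration.mono hsu _ hS)).mul
      ((measurable_const (a := (1 : ℝ))).indicator hEgt_u)
  have hg0m : Measurable g0 := hg0mu.mono (brownianFiltration.le u) le_rfl
  have hg0_01 : ∀ ω, g0 ω = 0 ∨ g0 ω = 1 := fun ω ↦ by
    rw [hg0]; simp only
    by_cases h1 : ω ∈ S
    · by_cases h2 : ω ∈ {ω | (u : WithTop ℝ≥0) < imgLocTimeK 6 hA hne n ω}
      · rw [Set.indicator_of_mem h1, Set.indicator_of_mem h2]; norm_num
      · rw [Set.indicator_of_mem h1, Set.indicator_of_notMem h2]; norm_num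
    · rw [Set.indicator_of_notMem h1, zero_mul]; exact Or.inl rfl
  have hg01 : ∀ ω, g0 ω ∈ Icc (0 : ℝ) 1 := fun ω ↦ by
    rcases hg0_01 ω with h | h <;> rw [h] <;> norm_num
  have hg0T : ∀ ω, g0 ω ≠ 0 → (u : WithTop ℝ≥0) < imgLocTimeK 6 hA hne n ω := fun ω hω ↦ by
    by_contra hnot
    exact hω (by rw [hg0]; simp only
                 rw [Set.indicator_of_notMem (show ω ∉ {ω | (u : WithTop ℝ≥0) < imgLocTimeK 6 hA hne n ω} from hnot), mul_zero])
  have hsupp : ∀ ω, g0 ω ≠ 0 → Disjoint (closedHull (drvK 6 (brownianCPath ω)) u) A ∧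
      Disjoint (ball (0 : ℂ) (8 * (locLevel n / 8))) (slidHull (drvK 6 (brownianCPath ω)) A u) ∧
        locLevel n ≤ starDeriv (slidHull (drvK 6 (brownianCPath ω)) A u) := fun ω hω ↦ by
    obtain ⟨halive, -, -, hd, hm⟩ := controlled_of_lt_locTimeK (lt_of_lt_of_le (hg0T ω hω) (imgLocTimeK_le_locTimeK n ω))
    refine ⟨halive, ?_, hd.le⟩
    rw [show 8 * (locLevel n / 8) = locLevel n by ring]
    exact disjoint_ball_infDist.mono_left (ball_subset_ball hm.le)
  have hMum : Measurable[brownianFiltration u] (imgMartK 6 hA hne n u) := ((stronglyAdapted_imgMartK (κ := 6) (hA := hA) (hne := hne) n) u).measurable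
  set g1 : (ℝ≥0 → ℝ) → ℝ := fun ω ↦ g0 ω * ((imgMartK 6 hA hne n u ω + N₀) / (2 * N₀)) with hg1
  have hg1mu : Measurable[brownianFiltration u] g1 := hg0mu.mul ((hMum.add_const _).div_const _)
  have hg11 : ∀ ω, g1 ω ∈ Icc (0 : ℝ) 1 := fun ω ↦ by
    have hM := hN₀M u ω
    rw [abs_le] at hM
    have hq0 : 0 ≤ (imgMartK 6 hA hne n u ω + N₀) / (2 * N₀) := div_nonneg (by linarith) (by positivity)
    have hq1 : (imgMartK 6 hA hne n u ω + N₀) / (2 * N₀) ≤ 1 := by rw [div_le_one (by positivity)]; linarith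
    rw [hg1]; simp only
    rcases hg0_01 ω with h | h
    · rw [h, zero_mul]; exact ⟨le_rfl, zero_le_one⟩
    · rw [h, one_mul]; exact ⟨hq0, hq1⟩
  have hsupp1 : ∀ ω, g1 ω ≠ 0 → Disjoint (closedHull (drvK 6 (brownianCPath ω)) u) A ∧
      Disjoint (ball (0 : ℂ) (8 * (locLevel n / 8))) (slidHull (drvK 6 (brownianCPath ω)) A u) ∧
        locLevel n ≤ starDeriv (slidHull (drvK 6 (brownianCPath ω)) A u) := fun ω hω ↦ by
    refine hsupp ω fun h0 ↦ hω ?_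
    rw [hg1]; simp only; rw [h0, zero_mul]
  -- abbreviations for the path quantities
  set Φd : (ℝ≥0 → ℝ) → ℝ := fun ω ↦ imageDrvFnK 6 A (u + h) (brownianCPath ω) - imageDrvFnK 6 A u (brownianCPath ω) with hΦd
  set dsq : (ℝ≥0 → ℝ) → ℝ := fun ω ↦ starDeriv (slidHull (drvK 6 (brownianCPath ω)) A u) ^ 2 with hdsq
  set Mu : (ℝ≥0 → ℝ) → ℝ := fun ω ↦ imgMartK 6 hA hne n u ω with hMu
  set ΔZ : (ℝ≥0 → ℝ) → ℝ := fun ω ↦ (imgMartK 6 hA hne n (u + h) ω ^ 2 - 6 * imgClockK 6 hA hne n (u + h) ω) -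
    (imgMartK 6 hA hne n u ω ^ 2 - 6 * imgClockK 6 hA hne n u ω) with hΔZ
  set defect : (ℝ≥0 → ℝ) → ℝ := fun ω ↦ ((imgMartK 6 hA hne n (u + h) ω - imgMartK 6 hA hne n u ω) ^ 2 - Φd ω ^ 2) +
    2 * imgMartK 6 hA hne n u ω * ((imgMartK 6 hA hne n (u + h) ω - imgMartK 6 hA hne n u ω) - Φd ω) -
    6 * ((imgClockK 6 hA hne n (u + h) ω - imgClockK 6 hA hne n u ω) - dsq ω * h) with hdefect
  have hdec : ∀ ω, S.indicator ΔZ ω = g0 ω * (Φd ω ^ 2 - 6 * dsq ω * h) + 2 * (g0 ω * Mu ω) * Φd ω + g0 ω * defect ω :=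
    fun ω ↦ indicator_imgBracket_sub_eq S u h ω
  -- integrability
  obtain ⟨hΦm, iΦ, iΦ2⟩ := integrable_imageDrv_sub hA (measurable_imageDrvFnK 6 hA hne) hR0 hAR u h
  have hΦm' : Measurable Φd := hΦm.comp measurable_brownianCPath
  have hbnd1 : ∀ᵐ ω ∂preWienerMeasure, ‖g0 ω‖ ≤ 1 := Eventually.of_forall fun ω ↦ by
    rw [Real.norm_eq_abs, abs_of_nonneg (hg01 ω).1]; exact (hg01 ω).2
  have hMum' : Measurable Mu := hMum.mono (brownianFiltration.le u) le_rfl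
  have hbnd2 : ∀ᵐ ω ∂preWienerMeasure, ‖2 * (g0 ω * Mu ω)‖ ≤ 2 * N₀ := Eventually.of_forall fun ω ↦ by
    rw [Real.norm_eq_abs, abs_mul, abs_two, abs_mul, abs_of_nonneg (hg01 ω).1]
    have := hN₀M u ω
    nlinarith [(hg01 ω).2, abs_nonneg (imgMartK 6 hA hne n u ω), (hg01 ω).1]
  -- `g0 * dsq` is measurable: on the support `dsq = imgRateK n u`
  have hgd : (fun ω ↦ g0 ω * (6 * dsq ω * h)) = fun ω ↦ g0 ω * (6 * imgRateK 6 hA hne n u ω * h) := by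
    funext ω
    by_cases hg : g0 ω = 0
    · rw [hg, zero_mul, zero_mul]
    · obtain ⟨-, -, hDeq, -, -⟩ := controlled_of_lt_locTimeK (lt_of_lt_of_le (hg0T ω hg) (imgLocTimeK_le_locTimeK n ω))
      rw [hdsq, imgRateK_def, hDeq]
  have hratem : Measurable (imgRateK 6 hA hne n u) :=
    ((isStronglyProgressive_imgRateK (κ := 6) (hA := hA) (hne := hne) n).stronglyAdapted u).measurable.mono (brownianFiltration.le u) le_rfl
  have i1a : Integrable (fun ω ↦ g0 ω * Φd ω ^ 2) preWienerMeasure := iΦ2.bdd_mul hg0m.aestronglyMeasurable hbnd1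
  have i1b : Integrable (fun ω ↦ g0 ω * (6 * dsq ω * h)) preWienerMeasure := by
    rw [hgd]
    refine (integrable_const (6 * (h : ℝ))).mono' (hg0m.mul ((measurable_const.mul hratem).mul measurable_const)).aestronglyMeasurable
      (Eventually.of_forall fun ω ↦ ?_)
    obtain ⟨r0, r1⟩ := imgRateK_mem_Icc (κ := 6) (hA := hA) (hne := hne) n u ω
    rw [Real.norm_eq_abs, abs_mul, abs_of_nonneg (hg01 ω).1, abs_of_nonneg (by positivity)]
    calc g0 ω * (6 * imgRateK 6 hA hne n u ω * h) ≤ 1 * (6 * 1 * h) := by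
          gcongr
          · exact (hg01 ω).2
      _ = 6 * h := by ring
  have i1 : Integrable (fun ω ↦ g0 ω * (Φd ω ^ 2 - 6 * dsq ω * h)) preWienerMeasure :=
    (i1a.sub i1b).congr (Eventually.of_forall fun ω ↦ by simp only [Pi.sub_apply]; ring)
  have i2 : Integrable (fun ω ↦ 2 * (g0 ω * Mu ω) * Φd ω) preWienerMeasure :=
    iΦ.bdd_mul ((measurable_const.mul (hg0m.mul hMum')).aestronglyMeasurable) hbnd2
  have iZ : Integrable ΔZ preWienerMeasure :=
    ((integrable_imgMartK_sq n _).sub ((integrable_imgClockK (κ := 6) (hA := hA) (hne := hne) n _).2.const_mul 6)).sub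
      ((integrable_imgMartK_sq n _).sub ((integrable_imgClockK (κ := 6) (hA := hA) (hne := hne) n _).2.const_mul 6))
  have i3 : Integrable (fun ω ↦ g0 ω * defect ω) preWienerMeasure := by
    have : (fun ω ↦ g0 ω * defect ω) = fun ω ↦ S.indicator ΔZ ω - (g0 ω * (Φd ω ^ 2 - 6 * dsq ω * h) + 2 * (g0 ω * Mu ω) * Φd ω) := by
      funext ω; rw [hdec ω]; ring
    rw [this]
    exact (iZ.indicator hSm).sub (i1.add i2)
  have i12 : Integrable (fun ω ↦ g0 ω * (Φd ω ^ 2 - 6 * dsq ω * h) + 2 * (g0 ω * Mu ω) * Φd ω) preWienerMeasure := i1.add i2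
  have hsplit : ∫ ω in S, ΔZ ω ∂preWienerMeasure =
      ∫ ω, g0 ω * (Φd ω ^ 2 - 6 * dsq ω * h) ∂preWienerMeasure + ∫ ω, 2 * (g0 ω * Mu ω) * Φd ω ∂preWienerMeasure +
        ∫ ω, g0 ω * defect ω ∂preWienerMeasure := by
    rw [← integral_indicator hSm, ← integral_add i1 i2, ← integral_add i12 i3]
    exact integral_congr_ae (Eventually.of_forall fun ω ↦ by simp only [hdec ω])
  rw [hsplit]
  -- (I) second moment
  have hI : |∫ ω, g0 ω * (Φd ω ^ 2 - 6 * dsq ω * h) ∂preWienerMeasure| ≤ C * h * Real.sqrt h :=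
    (hC u h hut hh0 hhc hg0mu hg01 hsupp).2
  -- (II) first moment with the weight `g0 Mu = 2N₀ g1 − N₀ g0`
  have hII : |∫ ω, 2 * (g0 ω * Mu ω) * Φd ω ∂preWienerMeasure| ≤ 6 * N₀ * (C * h * Real.sqrt h) := by
    have e1 := (hC u h hut hh0 hhc hg1mu hg11 hsupp1).1
    have e0 := (hC u h hut hh0 hhc hg0mu hg01 hsupp).1
    have ig1 : Integrable (fun ω ↦ g1 ω * Φd ω) preWienerMeasure :=
      iΦ.bdd_mul (hg1mu.mono (brownianFiltration.le u) le_rfl).aestronglyMeasurable (Eventually.of_forall fun ω ↦ by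
        rw [Real.norm_eq_abs, abs_of_nonneg (hg11 ω).1]; exact (hg11 ω).2)
    have ig0 : Integrable (fun ω ↦ g0 ω * Φd ω) preWienerMeasure := iΦ.bdd_mul hg0m.aestronglyMeasurable hbnd1
    have heq : (fun ω ↦ 2 * (g0 ω * Mu ω) * Φd ω) = fun ω ↦ 4 * N₀ * (g1 ω * Φd ω) - 2 * N₀ * (g0 ω * Φd ω) := by
      funext ω; rw [hg1]; simp only; field_simp; ring
    rw [heq, integral_sub (ig1.const_mul _) (ig0.const_mul _), integral_const_mul, integral_const_mul]
    calc |4 * N₀ * ∫ ω, g1 ω * Φd ω ∂preWienerMeasure - 2 * N₀ * ∫ ω, g0 ω * Φd ω ∂preWienerMeasure|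
        ≤ |4 * N₀ * ∫ ω, g1 ω * Φd ω ∂preWienerMeasure| + |2 * N₀ * ∫ ω, g0 ω * Φd ω ∂preWienerMeasure| := abs_sub _ _
      _ = 4 * N₀ * |∫ ω, g1 ω * Φd ω ∂preWienerMeasure| + 2 * N₀ * |∫ ω, g0 ω * Φd ω ∂preWienerMeasure| := by
          rw [abs_mul (4 * N₀), abs_mul (2 * N₀), abs_of_nonneg (by positivity : (0 : ℝ) ≤ 4 * N₀),
            abs_of_nonneg (by positivity : (0 : ℝ) ≤ 2 * N₀)]
      _ ≤ 4 * N₀ * (C * h * Real.sqrt h) + 2 * N₀ * (C * h * Real.sqrt h) := by gcongr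
      _ = _ := by ring
  -- (III) the defect
  have hEm : MeasurableSet {ω | (u : WithTop ℝ≥0) < imgLocTimeK 6 hA hne n ω ∧
      imgLocTimeK 6 hA hne n ω < ((u + h : ℝ≥0) : WithTop ℝ≥0)} := hEgt.inter hElt
  have hBadm : MeasurableSet {ω | κ₀ / Real.sqrt 6 ≤ oscFn h (incr u (brownianCPath ω))} :=
    measurableSet_le measurable_const ((measurable_oscFn h).comp ((measurable_incr u).comp measurable_brownianCPath))
  have hk : 0 < κ₀ / Real.sqrt 6 := div_pos hκ₀ (Real.sqrt_pos.2 (by norm_num))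
  obtain ⟨iBX, iBX2, hBX, hBX2⟩ := integral_indicator_oscFn_mul_runSup_pow_le h u hk hh0
  have hPBad := measureReal_oscFn_incr_ge_le_pow_four h u hk hh0
  have hce0 : 0 ≤ cellErr n κ₀ h := by rw [cellErr, stepSize]; positivity
  have hpt : ∀ ω, |g0 ω * defect ω| ≤
      {ω | (u : WithTop ℝ≥0) < imgLocTimeK 6 hA hne n ω ∧ imgLocTimeK 6 hA hne n ω < ((u + h : ℝ≥0) : WithTop ℝ≥0)}.indicator
          (fun _ ↦ D ^ 2 + 2 * N₀ * D + 6 * (h : ℝ)) ω + 12 * h * cellErr n κ₀ h +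
        (8 * (((n : ℝ) + 1) + 1160 * (3 * ((n : ℝ) + 1) + 13 * Real.sqrt ((n : ℝ) + 1) + R)) ^ 2 + 2 * (15080 * Real.sqrt ((t₁ : ℝ) + 1) + 1160 * R) ^ 2 + 2 * (((n : ℝ) + 1) + 1160 * (3 * ((n : ℝ) + 1) + 13 * Real.sqrt ((n : ℝ) + 1) + R)) * (15080 * Real.sqrt ((t₁ : ℝ) + 1) + 1160 * R) + 12) * {ω | κ₀ / Real.sqrt 6 ≤ oscFn h (incr u (brownianCPath ω))}.indicator (fun _ ↦ (1 : ℝ)) ω +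
        (2 * (((n : ℝ) + 1) + 1160 * (3 * ((n : ℝ) + 1) + 13 * Real.sqrt ((n : ℝ) + 1) + R)) * (3482 * Real.sqrt 6) + 4 * (15080 * Real.sqrt ((t₁ : ℝ) + 1) + 1160 * R) * (3482 * Real.sqrt 6)) * ({ω | κ₀ / Real.sqrt 6 ≤ oscFn h (incr u (brownianCPath ω))}.indicator (fun _ ↦ (1 : ℝ)) ω * runSup (u + h) ω) +
        (2 * (3482 * Real.sqrt 6) ^ 2) * ({ω | κ₀ / Real.sqrt 6 ≤ oscFn h (incr u (brownianCPath ω))}.indicator (fun _ ↦ (1 : ℝ)) ω * runSup (u + h) ω ^ 2) := by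
    intro ω
    by_cases hg : g0 ω = 0
    · rw [hg, zero_mul, abs_zero]
      have hEv0 : 0 ≤ D ^ 2 + 2 * N₀ * D + 6 * (h : ℝ) := by positivity
      have := Set.indicator_nonneg (fun _ _ ↦ hEv0)
        (s := {ω | (u : WithTop ℝ≥0) < imgLocTimeK 6 hA hne n ω ∧ imgLocTimeK 6 hA hne n ω < ((u + h : ℝ≥0) : WithTop ℝ≥0)}) ω
      have := Set.indicator_nonneg (fun _ _ ↦ zero_le_one (α := ℝ)) (s := {ω | κ₀ / Real.sqrt 6 ≤ oscFn h (incr u (brownianCPath ω))}) ω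
      have := Process.runSup_nonneg (u + h) ω
      positivity
    · rcases hg0_01 ω with h0 | h1
      · exact absurd h0 hg
      rw [h1, one_mul]
      exact abs_imgBracketDefect_le hR0 hAR hut hh0 hh1 hκ₀ hh2 (hg0T ω hg)
  -- integrate the defect bound
  have hIII := abs_integral_le_of_five_terms hEm hBadm i3 iBX iBX2 hpt
  -- arithmetic on the junk terms
  have hh2' : (h : ℝ) ^ 4 ≤ h ^ 2 := pow_le_pow_of_le_one h.coe_nonneg hh1 (by norm_num)
  have hh3' : (h : ℝ) ^ 3 ≤ h ^ 2 := pow_le_pow_of_le_one h.coe_nonneg hh1 (by norm_num)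
  have huh : ((u + h : ℝ≥0) : ℝ) ^ 2 ≤ ((t₁ : ℝ) + 1) ^ 2 := by
    have huh' : ((u + h : ℝ≥0) : ℝ) ≤ (t₁ : ℝ) + 1 := by push_cast; exact add_le_add (by exact_mod_cast hut) hh1
    exact pow_le_pow_left₀ (by positivity) huh' 2
  have hk8 : 0 ≤ 768 / (κ₀ / Real.sqrt 6) ^ 8 := by positivity
  have ha1 : 0 ≤ (8 * (((n : ℝ) + 1) + 1160 * (3 * ((n : ℝ) + 1) + 13 * Real.sqrt ((n : ℝ) + 1) + R)) ^ 2 + 2 * (15080 * Real.sqrt ((t₁ : ℝ) + 1) + 1160 * R) ^ 2 + 2 * (((n : ℝ) + 1) + 1160 * (3 * ((n : ℝ) + 1) + 13 * Real.sqrt ((n : ℝ) + 1) + R)) * (15080 * Real.sqrt ((t₁ : ℝ) + 1) + 1160 * R) + 12) := by positivity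
  have ha2 : 0 ≤ (2 * (((n : ℝ) + 1) + 1160 * (3 * ((n : ℝ) + 1) + 13 * Real.sqrt ((n : ℝ) + 1) + R)) * (3482 * Real.sqrt 6) + 4 * (15080 * Real.sqrt ((t₁ : ℝ) + 1) + 1160 * R) * (3482 * Real.sqrt 6)) := by positivity
  have ha3 : 0 ≤ (2 * (3482 * Real.sqrt 6) ^ 2) := by positivity
  have j1 : (8 * (((n : ℝ) + 1) + 1160 * (3 * ((n : ℝ) + 1) + 13 * Real.sqrt ((n : ℝ) + 1) + R)) ^ 2 + 2 * (15080 * Real.sqrt ((t₁ : ℝ) + 1) + 1160 * R) ^ 2 + 2 * (((n : ℝ) + 1) + 1160 * (3 * ((n : ℝ) + 1) + 13 * Real.sqrt ((n : ℝ) + 1) + R)) * (15080 * Real.sqrt ((t₁ : ℝ) + 1) + 1160 * R) + 12) * preWienerMeasure.real {ω | κ₀ / Real.sqrt 6 ≤ oscFn h (incr u (brownianCPath ω))} ≤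
      (8 * (((n : ℝ) + 1) + 1160 * (3 * ((n : ℝ) + 1) + 13 * Real.sqrt ((n : ℝ) + 1) + R)) ^ 2 + 2 * (15080 * Real.sqrt ((t₁ : ℝ) + 1) + 1160 * R) ^ 2 + 2 * (((n : ℝ) + 1) + 1160 * (3 * ((n : ℝ) + 1) + 13 * Real.sqrt ((n : ℝ) + 1) + R)) * (15080 * Real.sqrt ((t₁ : ℝ) + 1) + 1160 * R) + 12) * (768 / (κ₀ / Real.sqrt 6) ^ 8) * (h : ℝ) ^ 2 := by
    have : preWienerMeasure.real {ω | κ₀ / Real.sqrt 6 ≤ oscFn h (incr u (brownianCPath ω))} ≤ 768 / (κ₀ / Real.sqrt 6) ^ 8 * (h : ℝ) ^ 2 := by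
      refine hPBad.trans ?_
      rw [show 768 * (h : ℝ) ^ 4 / (κ₀ / Real.sqrt 6) ^ 8 = 768 / (κ₀ / Real.sqrt 6) ^ 8 * h ^ 4 by ring]
      exact mul_le_mul_of_nonneg_left hh2' hk8
    have := mul_le_mul_of_nonneg_left this ha1
    linarith
  have j2 : (2 * (((n : ℝ) + 1) + 1160 * (3 * ((n : ℝ) + 1) + 13 * Real.sqrt ((n : ℝ) + 1) + R)) * (3482 * Real.sqrt 6) + 4 * (15080 * Real.sqrt ((t₁ : ℝ) + 1) + 1160 * R) * (3482 * Real.sqrt 6)) * ∫ ω, {ω | κ₀ / Real.sqrt 6 ≤ oscFn h (incr u (brownianCPath ω))}.indicator (fun _ ↦ (1 : ℝ)) ω * runSup (u + h) ω ∂preWienerMeasure ≤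
      (2 * (((n : ℝ) + 1) + 1160 * (3 * ((n : ℝ) + 1) + 13 * Real.sqrt ((n : ℝ) + 1) + R)) * (3482 * Real.sqrt 6) + 4 * (15080 * Real.sqrt ((t₁ : ℝ) + 1) + 1160 * R) * (3482 * Real.sqrt 6)) * (768 / (κ₀ / Real.sqrt 6) ^ 8 + 18 * ((t₁ : ℝ) + 1) ^ 2) * (h : ℝ) ^ 2 := by
    have : ∫ ω, {ω | κ₀ / Real.sqrt 6 ≤ oscFn h (incr u (brownianCPath ω))}.indicator (fun _ ↦ (1 : ℝ)) ω * runSup (u + h) ω ∂preWienerMeasure ≤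
        (768 / (κ₀ / Real.sqrt 6) ^ 8 + 18 * ((t₁ : ℝ) + 1) ^ 2) * (h : ℝ) ^ 2 := by
      refine hBX.trans ?_
      have e1 : 768 * (h : ℝ) ^ 3 / (κ₀ / Real.sqrt 6) ^ 8 = 768 / (κ₀ / Real.sqrt 6) ^ 8 * h ^ 3 := by ring
      rw [e1]
      have p1 := mul_le_mul_of_nonneg_left hh3' hk8
      have p2 : ((u + h : ℝ≥0) : ℝ) ^ 2 * (h : ℝ) ^ 3 ≤ ((t₁ : ℝ) + 1) ^ 2 * (h : ℝ) ^ 2 :=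
        mul_le_mul huh hh3' (by positivity) (by positivity)
      linarith
    have := mul_le_mul_of_nonneg_left this ha2
    linarith
  have j3 : (2 * (3482 * Real.sqrt 6) ^ 2) * ∫ ω, {ω | κ₀ / Real.sqrt 6 ≤ oscFn h (incr u (brownianCPath ω))}.indicator (fun _ ↦ (1 : ℝ)) ω * runSup (u + h) ω ^ 2 ∂preWienerMeasure ≤
      (2 * (3482 * Real.sqrt 6) ^ 2) * (768 / (κ₀ / Real.sqrt 6) ^ 8 + 18 * ((t₁ : ℝ) + 1) ^ 2) * (h : ℝ) ^ 2 := by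
    have : ∫ ω, {ω | κ₀ / Real.sqrt 6 ≤ oscFn h (incr u (brownianCPath ω))}.indicator (fun _ ↦ (1 : ℝ)) ω * runSup (u + h) ω ^ 2 ∂preWienerMeasure ≤
        (768 / (κ₀ / Real.sqrt 6) ^ 8 + 18 * ((t₁ : ℝ) + 1) ^ 2) * (h : ℝ) ^ 2 := by
      refine hBX2.trans ?_
      have e1 : 768 * (h : ℝ) ^ 2 / (κ₀ / Real.sqrt 6) ^ 8 = 768 / (κ₀ / Real.sqrt 6) ^ 8 * h ^ 2 := by ring
      rw [e1]
      have p3 : ((u + h : ℝ≥0) : ℝ) ^ 2 * (h : ℝ) ^ 2 ≤ ((t₁ : ℝ) + 1) ^ 2 * (h : ℝ) ^ 2 :=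
        mul_le_mul_of_nonneg_right huh (by positivity)
      linarith
    have := mul_le_mul_of_nonneg_left this ha3
    linarith
  calc |∫ ω, g0 ω * (Φd ω ^ 2 - 6 * dsq ω * h) ∂preWienerMeasure + ∫ ω, 2 * (g0 ω * Mu ω) * Φd ω ∂preWienerMeasure +
        ∫ ω, g0 ω * defect ω ∂preWienerMeasure|
      ≤ |∫ ω, g0 ω * (Φd ω ^ 2 - 6 * dsq ω * h) ∂preWienerMeasure| + |∫ ω, 2 * (g0 ω * Mu ω) * Φd ω ∂preWienerMeasure| +
          |∫ ω, g0 ω * defect ω ∂preWienerMeasure| := (abs_add_le _ _).trans (add_le_add (abs_add_le _ _) le_rfl)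
    _ ≤ C * h * Real.sqrt h + 6 * N₀ * (C * h * Real.sqrt h) +
          ((D ^ 2 + 2 * N₀ * D + 6 * (h : ℝ)) * preWienerMeasure.real {ω | (u : WithTop ℝ≥0) < imgLocTimeK 6 hA hne n ω ∧
            imgLocTimeK 6 hA hne n ω < ((u + h : ℝ≥0) : WithTop ℝ≥0)} + 12 * h * cellErr n κ₀ h +
          (8 * (((n : ℝ) + 1) + 1160 * (3 * ((n : ℝ) + 1) + 13 * Real.sqrt ((n : ℝ) + 1) + R)) ^ 2 + 2 * (15080 * Real.sqrt ((t₁ : ℝ) + 1) + 1160 * R) ^ 2 + 2 * (((n : ℝ) + 1) + 1160 * (3 * ((n : ℝ) + 1) + 13 * Real.sqrt ((n : ℝ) + 1) + R)) * (15080 * Real.sqrt ((t₁ : ℝ) + 1) + 1160 * R) + 12) * (768 / (κ₀ / Real.sqrt 6) ^ 8) * (h : ℝ) ^ 2 +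
          (2 * (((n : ℝ) + 1) + 1160 * (3 * ((n : ℝ) + 1) + 13 * Real.sqrt ((n : ℝ) + 1) + R)) * (3482 * Real.sqrt 6) + 4 * (15080 * Real.sqrt ((t₁ : ℝ) + 1) + 1160 * R) * (3482 * Real.sqrt 6)) * (768 / (κ₀ / Real.sqrt 6) ^ 8 + 18 * ((t₁ : ℝ) + 1) ^ 2) * (h : ℝ) ^ 2 +
          (2 * (3482 * Real.sqrt 6) ^ 2) * (768 / (κ₀ / Real.sqrt 6) ^ 8 + 18 * ((t₁ : ℝ) + 1) ^ 2) * (h : ℝ) ^ 2) := by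
        refine add_le_add (add_le_add hI hII) (hIII.trans ?_)
        linarith [j1, j2, j3]
    _ = _ := by ring

end Cell

end Literature.Probability.RandomPlanarGeometry

end
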